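import Literature.NumberTheory.Transcendental.KontsevichZagier
import Literature.NumberTheory.Transcendental.KZPeriodsProofs
import Literature.NumberTheory.Transcendental.KontsevichZagierEllipticLiftProofs
import Mathlib.Data.ZMod.Basic
import HarnessLib

/-!
# Quasi-periods from two root-to-root segments: the parity argument

Topic `Literature/NumberTheory/Transcendental` (family `periods`). This file is the algebraic
assembly step in the discharge of the named facts
`Literature.NumberTheory.Transcendental.isPeriod_η₁`, `isPeriod_η₂` and `isPeriod_of_mem_lattice`
of `KontsevichZagier.lean` (Kontsevich–Zagier 2001, §1.1: the periods and quasi-periods of an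
elliptic curve with algebraic `g₂, g₃` are periods, being the elliptic integrals `∮ dx/y`,
`-∮ x dx/y`). It contains no analysis and no semialgebraic geometry: it explains how to recover
`η₁, η₂` (and `ω₁, ω₂`) from the values of such integrals **without knowing the homology classes
of the paths**, which is what makes a topology-free formalisation possible.

## The argument (all proved here)

Let `Λ = ℤω₁ + ℤω₂`, `℘ = ℘_Λ`, `ζ = ζ_Λ`, `f(x) = 4x³ - g₂x - g₃`, and let `η : Λ → ℂ`,
`η(mω₁ + nω₂) = mη₁ + nη₂`, be the quasi-period map (`ζ(z + λ) = ζ(z) + η(λ)`).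

* *Half-lattice points.* If `w ∉ Λ`, `2w ∈ Λ` then `℘'(w) = 0` and `2ζ(w) = η(2w)` (tree:
  `two_mul_weierstrassZeta_half_lattice`). Hence for two such points `w₀, w₁`,
  `2(ζ(w₁) - ζ(w₀)) = η(2w₁ - 2w₀)`; and `℘(w₀) = ℘(w₁)` iff `w₁ - w₀ ∈ Λ`
  (`PeriodPair.sub_mem_lattice_of_weierstrassP_eq`).
* *Parity.* Suppose `w₀, w₁` are half-lattice points over two **distinct** roots `p = ℘(w₀)`,
  `q = ℘(w₁)`, and `w₀', w₁'` are half-lattice points over `p` and a third root `r ∉ {p, q}`.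
  Write `2(w₁ - w₀) = αω₁ + βω₂`, `2(w₁' - w₀') = γω₁ + δω₂`. Then `(α, β)`, `(γ, δ)` and
  `(α - γ, β - δ)` are all `≢ (0, 0) (mod 2)` (otherwise `w₁ - w₀ ∈ Λ`, resp. `w₁' - w₀' ∈ Λ`,
  resp. `w₁ - w₁' ∈ Λ` using `w₀ - w₀' ∈ Λ`, contradicting the distinctness of the roots), and
  three such vectors in `𝔽₂²` force `D = αδ - βγ ≡ 1 (mod 2)`, so `D ≠ 0`
  (`det_ne_zero_of_parity`).
* *Extraction.* With `2S = αη₁ + βη₂`, `2S' = γη₁ + δη₂` (`S = ζ(w₁) - ζ(w₀)`,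
  `S' = ζ(w₁') - ζ(w₀')`) Cramer's rule gives `Dη₁ = 2(δS - βS')`, `Dη₂ = 2(αS' - γS)`; since the
  Kontsevich–Zagier periods form a `ℚ`-algebra (tree: `IsPeriod.add_holds`, `IsPeriod.mul_holds`,
  `isPeriod_ratCast_holds`), `η₁, η₂` are periods as soon as `S, S'` are
  (`isPeriod_η₁_η₂_of_segments`), and likewise `ω₁, ω₂` — hence all of `Λ` — as soon as
  `w₁ - w₀`, `w₁' - w₀'` are (`isPeriod_of_mem_lattice_of_segments`).

The inputs `S, S'` (and `w₁ - w₀`, `w₁' - w₀'`) are produced by the segment lift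
(`KontsevichZagierEllipticLiftProofs.lean`, `KontsevichZagierEllipticLift.lean`) as the elliptic
integrals `-∫ x dx/y` (and `∫ dx/y`) along the segments `[p, q]`, `[p, r]`.

Also proved here, for the final assembly: the elementary theory of the three roots of the
Weierstrass cubic of a period pair (`℘(ω₁/2)`, `℘(ω₂/2)` are distinct simple roots, the third
root is minus their sum, a root other than `p, q` is the third one; algebraicity of the roots for
algebraic `g₂, g₃` is the tree's `isAlgebraic_of_cubic_eq_zero`, `KZIntervalPeriodProofs.lean`)
and the choice of a vertex `p` among three distinct points of `ℂ` such that neither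
of the other two lies on the closed segment from `p` to the remaining one
(`exists_vertex_of_three_points`).

## References

* M. Kontsevich, D. Zagier, *Periods* (2001), §1.1.
* E. T. Whittaker, G. N. Watson, *A Course of Modern Analysis*, §20.32, §20.41.

## Design notes

Theorems only; no definitions, no named facts. The namespace is the path namespace.
-/

noncomputable section

open Complex Set
open scoped PeriodPair

namespace Literature.NumberTheory.Transcendental

variable (L : PeriodPair)

/-! ### Periods form a `ℚ`-algebra: the closure properties used -/

/-- Integers are periods. [cite: KontsevichZagier2001, §1.1] -/
theorem isPeriod_intCast (n : ℤ) : IsPeriod (n : ℂ) := by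
  simpa using isPeriod_ratCast_holds (n : ℚ)

/-- `D⁻¹ (a z + b w)` is a period for periods `z, w` and integers `a, b, D`.
[cite: KontsevichZagier2001, §1.1] -/
theorem isPeriod_inv_mul_add {z w : ℂ} (hz : IsPeriod z) (hw : IsPeriod w) (a b D : ℤ) :
    IsPeriod ((D : ℂ)⁻¹ * (a * z + b * w)) := by
  have hD : IsPeriod ((D : ℂ)⁻¹) := by simpa using isPeriod_ratCast_holds ((D : ℚ)⁻¹)
  exact IsPeriod.mul_holds hD (IsPeriod.add_holds (IsPeriod.mul_holds (isPeriod_intCast a) hz)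
    (IsPeriod.mul_holds (isPeriod_intCast b) hw))

/-! ### Parity -/

/-- The `𝔽₂`-linear-algebra fact behind the parity argument: if `(α, β)`, `(γ, δ)` and
`(α - γ, β - δ)` are all nonzero modulo `2`, then `αδ - βγ` is odd (two distinct nonzero vectors of
`𝔽₂²` form a basis). [folklore] -/
theorem det_ne_zero_of_parity {α β γ δ : ℤ} (h₁ : ¬ (2 ∣ α ∧ 2 ∣ β)) (h₂ : ¬ (2 ∣ γ ∧ 2 ∣ δ))
    (h₃ : ¬ (2 ∣ (α - γ) ∧ 2 ∣ (β - δ))) : α * δ - β * γ ≠ 0 := by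
  intro hD
  have key : ∀ a b c d : ZMod 2, ¬ (a = 0 ∧ b = 0) → ¬ (c = 0 ∧ d = 0) →
      ¬ (a - c = 0 ∧ b - d = 0) → a * d - b * c ≠ 0 := by decide
  have e : ∀ z : ℤ, ((z : ZMod 2) = 0) ↔ 2 ∣ z := fun z => by
    simpa using ZMod.intCast_zmod_eq_zero_iff_dvd z 2
  simp only [← e, Int.cast_sub] at h₁ h₂ h₃
  refine key _ _ _ _ h₁ h₂ h₃ ?_
  have h := congrArg (fun z : ℤ => (z : ZMod 2)) hD
  simpa using h

/-! ### Half-lattice points -/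

variable {L}

/-- If `w₀, w₁` are half-lattice representatives (`wᵢ ∉ Λ`, `2wᵢ ∈ Λ`) over **distinct** values
`℘(w₀) ≠ ℘(w₁)`, and `2(w₁ - w₀) = αω₁ + βω₂`, then `α, β` are not both even (otherwise
`w₁ - w₀ ∈ Λ` and `℘(w₁) = ℘(w₀)` by periodicity). [folklore] -/
theorem not_two_dvd_of_weierstrassP_ne {w₀ w₁ : ℂ} {α β : ℤ}
    (h : 2 * (w₁ - w₀) = α * L.ω₁ + β * L.ω₂) (hne : ℘[L] w₀ ≠ ℘[L] w₁) :
    ¬ (2 ∣ α ∧ 2 ∣ β) := by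
  rintro ⟨⟨α', rfl⟩, ⟨β', rfl⟩⟩
  have hmem : w₁ - w₀ ∈ L.lattice := by
    have e : w₁ - w₀ = α' * L.ω₁ + β' * L.ω₂ := by
      push_cast at h
      linear_combination h / 2
    rw [e]
    exact PeriodPair.mem_lattice.2 ⟨α', β', rfl⟩
  apply hne
  have := L.weierstrassP_add_coe w₀ ⟨w₁ - w₀, hmem⟩
  simp only [add_sub_cancel] at this
  exact this.symm

/-- `2ζ(w₁) - 2ζ(w₀) = αη₁ + βη₂` when `2w₀, 2w₁ ∈ Λ` and `2(w₁ - w₀) = αω₁ + βω₂`: the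
half-quasi-period along `w₁ - w₀` (from `2ζ(λ/2) = η(λ)`, tree lemma
`two_mul_weierstrassZeta_half_lattice`; Whittaker–Watson §20.41).
[cite: WhittakerWatson1927, §20.41] -/
theorem two_mul_weierstrassZeta_sub {w₀ w₁ : ℂ} (h₀ : 2 * w₀ ∈ L.lattice) (h₁ : 2 * w₁ ∈ L.lattice)
    {α β : ℤ} (h : 2 * (w₁ - w₀) = α * L.ω₁ + β * L.ω₂) :
    2 * (L.weierstrassZeta w₁ - L.weierstrassZeta w₀) = α * L.η₁ + β * L.η₂ := by
  obtain ⟨m₀, n₀, e₀⟩ := PeriodPair.mem_lattice.1 h₀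
  obtain ⟨m₁, n₁, e₁⟩ := PeriodPair.mem_lattice.1 h₁
  have z₀ := two_mul_weierstrassZeta_half_lattice L m₀ n₀
  have z₁ := two_mul_weierstrassZeta_half_lattice L m₁ n₁
  rw [e₀, show 2 * w₀ / 2 = w₀ by ring] at z₀
  rw [e₁, show 2 * w₁ / 2 = w₁ by ring] at z₁
  -- compare coefficients: `α = m₁ - m₀`, `β = n₁ - n₀` by linear independence
  have hlin : ((m₁ - m₀ - α : ℤ) : ℂ) * L.ω₁ + ((n₁ - n₀ - β : ℤ) : ℂ) * L.ω₂ = 0 := by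
    push_cast
    linear_combination e₁ - e₀ + h
  have hind := LinearIndependent.pair_iff.1 L.indep ((m₁ - m₀ - α : ℤ) : ℝ) ((n₁ - n₀ - β : ℤ) : ℝ)
    (by
      have : (((m₁ - m₀ - α : ℤ) : ℝ) : ℂ) * L.ω₁ + (((n₁ - n₀ - β : ℤ) : ℝ) : ℂ) * L.ω₂ = 0 := by
        exact_mod_cast hlin
      simpa [Complex.real_smul] using this)
  have hα : (α : ℂ) = m₁ - m₀ := by
    have := hind.1
    have h' : (m₁ - m₀ - α : ℤ) = 0 := by exact_mod_cast this
    have : α = m₁ - m₀ := by omega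
    rw [this]
    push_cast
    ring
  have hβ : (β : ℂ) = n₁ - n₀ := by
    have := hind.2
    have h' : (n₁ - n₀ - β : ℤ) = 0 := by exact_mod_cast this
    have : β = n₁ - n₀ := by omega
    rw [this]
    push_cast
    ring
  rw [hα, hβ]
  linear_combination z₁ - z₀

/-! ### Extraction of `η₁, η₂` and of `ω₁, ω₂` from two segments -/

/-- **Cramer extraction of the quasi-periods.** Given half-lattice representatives `w₀, w₁`
over two distinct values `p = ℘(w₀) ≠ q = ℘(w₁)` and `w₀', w₁'` over `p = ℘(w₀')` and a third
value `r = ℘(w₁') ∉ {p, q}`, the differences `S = ζ(w₁) - ζ(w₀)`, `S' = ζ(w₁') - ζ(w₀')` determine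
`η₁, η₂` rationally: writing `2(w₁ - w₀) = αω₁ + βω₂`, `2(w₁' - w₀') = γω₁ + δω₂` one has
`D = αδ - βγ ≠ 0` (parity) and `Dη₁ = 2(δS - βS')`, `Dη₂ = 2(αS' - γS)`. In particular
**`η₁` and `η₂` are Kontsevich–Zagier periods as soon as `S` and `S'` are.**
[Kontsevich–Zagier 2001, §1.1 (quasi-periods of elliptic curves over `ℚ̄` are periods)]
[cite: KontsevichZagier2001, §1.1] -/
theorem isPeriod_η₁_η₂_of_segments {w₀ w₁ w₀' w₁' : ℂ}
    (hw₀ : w₀ ∉ L.lattice) (hw₀' : w₀' ∉ L.lattice)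
    (h2w₀ : 2 * w₀ ∈ L.lattice) (h2w₁ : 2 * w₁ ∈ L.lattice) (h2w₀' : 2 * w₀' ∈ L.lattice)
    (h2w₁' : 2 * w₁' ∈ L.lattice)
    (hpp : ℘[L] w₀ = ℘[L] w₀') (hpq : ℘[L] w₀ ≠ ℘[L] w₁) (hpr : ℘[L] w₀' ≠ ℘[L] w₁')
    (hqr : ℘[L] w₁ ≠ ℘[L] w₁')
    (hS : IsPeriod (L.weierstrassZeta w₁ - L.weierstrassZeta w₀))
    (hS' : IsPeriod (L.weierstrassZeta w₁' - L.weierstrassZeta w₀')) :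
    IsPeriod L.η₁ ∧ IsPeriod L.η₂ := by
  -- coordinates of the two lattice vectors
  obtain ⟨α, β, hαβ⟩ := PeriodPair.mem_lattice.1
    (show 2 * (w₁ - w₀) ∈ L.lattice by rw [mul_sub]; exact sub_mem h2w₁ h2w₀)
  obtain ⟨γ, δ, hγδ⟩ := PeriodPair.mem_lattice.1
    (show 2 * (w₁' - w₀') ∈ L.lattice by rw [mul_sub]; exact sub_mem h2w₁' h2w₀')
  have hαβ' : 2 * (w₁ - w₀) = α * L.ω₁ + β * L.ω₂ := hαβ.symm
  have hγδ' : 2 * (w₁' - w₀') = γ * L.ω₁ + δ * L.ω₂ := hγδ.symm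
  -- parity
  have p₁ := not_two_dvd_of_weierstrassP_ne hαβ' hpq
  have p₂ := not_two_dvd_of_weierstrassP_ne hγδ' hpr
  have h00 : w₀ - w₀' ∈ L.lattice :=
    L.sub_mem_lattice_of_weierstrassP_eq hw₀ hw₀' hpp
      (by rw [derivWeierstrassP_eq_zero_of_two_mul_mem L h2w₀,
        derivWeierstrassP_eq_zero_of_two_mul_mem L h2w₀'])
  obtain ⟨m, n, hmn⟩ := PeriodPair.mem_lattice.1 h00
  have p₃ : ¬ (2 ∣ (α - γ) ∧ 2 ∣ (β - δ)) := by
    have e : 2 * (w₁ - (w₁' + (w₀ - w₀'))) = (α - γ : ℤ) * L.ω₁ + (β - δ : ℤ) * L.ω₂ := by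
      push_cast
      linear_combination hαβ' - hγδ'
    have e' : 2 * (w₁ - w₁') = (α - γ + 2 * m : ℤ) * L.ω₁ + (β - δ + 2 * n : ℤ) * L.ω₂ := by
      push_cast at e ⊢
      linear_combination e - 2 * hmn
    have := not_two_dvd_of_weierstrassP_ne e' hqr.symm
    rintro ⟨ha, hb⟩
    exact this ⟨(Int.dvd_add_right ha).2 (dvd_mul_right 2 m), (Int.dvd_add_right hb).2 (dvd_mul_right 2 n)⟩
  have hD : α * δ - β * γ ≠ 0 := det_ne_zero_of_parity p₁ p₂ p₃
  have hDc : ((α * δ - β * γ : ℤ) : ℂ) ≠ 0 := by exact_mod_cast hD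
  -- the two half-quasi-periods
  have hS2 := two_mul_weierstrassZeta_sub h2w₀ h2w₁ hαβ'
  have hS'2 := two_mul_weierstrassZeta_sub h2w₀' h2w₁' hγδ'
  set S := L.weierstrassZeta w₁ - L.weierstrassZeta w₀ with hSdef
  set S' := L.weierstrassZeta w₁' - L.weierstrassZeta w₀' with hS'def
  -- Cramer
  have hη₁ : L.η₁ = ((α * δ - β * γ : ℤ) : ℂ)⁻¹ * ((2 * δ : ℤ) * S + (-2 * β : ℤ) * S') := by
    rw [eq_inv_mul_iff_mul_eq₀ hDc]
    push_cast
    linear_combination β * hS'2 - δ * hS2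
  have hη₂ : L.η₂ = ((α * δ - β * γ : ℤ) : ℂ)⁻¹ * ((-2 * γ : ℤ) * S + (2 * α : ℤ) * S') := by
    rw [eq_inv_mul_iff_mul_eq₀ hDc]
    push_cast
    linear_combination γ * hS2 - α * hS'2
  exact ⟨hη₁ ▸ isPeriod_inv_mul_add hS hS' _ _ _, hη₂ ▸ isPeriod_inv_mul_add hS hS' _ _ _⟩

/-- **Cramer extraction of the periods.** In the situation of `isPeriod_η₁_η₂_of_segments`,
`Dω₁ = 2(δT - βT')`, `Dω₂ = 2(αT' - γT)` with `T = w₁ - w₀`, `T' = w₁' - w₀'` the two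
half-periods; hence **every element of `Λ` is a Kontsevich–Zagier period as soon as `T, T'` are**.
[Kontsevich–Zagier 2001, §1.1 (periods of elliptic curves over `ℚ̄`)]
[cite: KontsevichZagier2001, §1.1] -/
theorem isPeriod_of_mem_lattice_of_segments {w₀ w₁ w₀' w₁' : ℂ}
    (hw₀ : w₀ ∉ L.lattice) (hw₀' : w₀' ∉ L.lattice)
    (h2w₀ : 2 * w₀ ∈ L.lattice) (h2w₁ : 2 * w₁ ∈ L.lattice) (h2w₀' : 2 * w₀' ∈ L.lattice)
    (h2w₁' : 2 * w₁' ∈ L.lattice)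
    (hpp : ℘[L] w₀ = ℘[L] w₀') (hpq : ℘[L] w₀ ≠ ℘[L] w₁) (hpr : ℘[L] w₀' ≠ ℘[L] w₁')
    (hqr : ℘[L] w₁ ≠ ℘[L] w₁')
    (hT : IsPeriod (w₁ - w₀)) (hT' : IsPeriod (w₁' - w₀')) {l : ℂ} (hl : l ∈ L.lattice) :
    IsPeriod l := by
  obtain ⟨α, β, hαβ⟩ := PeriodPair.mem_lattice.1
    (show 2 * (w₁ - w₀) ∈ L.lattice by rw [mul_sub]; exact sub_mem h2w₁ h2w₀)
  obtain ⟨γ, δ, hγδ⟩ := PeriodPair.mem_lattice.1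
    (show 2 * (w₁' - w₀') ∈ L.lattice by rw [mul_sub]; exact sub_mem h2w₁' h2w₀')
  have hαβ' : 2 * (w₁ - w₀) = α * L.ω₁ + β * L.ω₂ := hαβ.symm
  have hγδ' : 2 * (w₁' - w₀') = γ * L.ω₁ + δ * L.ω₂ := hγδ.symm
  have p₁ := not_two_dvd_of_weierstrassP_ne hαβ' hpq
  have p₂ := not_two_dvd_of_weierstrassP_ne hγδ' hpr
  have h00 : w₀ - w₀' ∈ L.lattice :=
    L.sub_mem_lattice_of_weierstrassP_eq hw₀ hw₀' hpp
      (by rw [derivWeierstrassP_eq_zero_of_two_mul_mem L h2w₀,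
        derivWeierstrassP_eq_zero_of_two_mul_mem L h2w₀'])
  obtain ⟨m, n, hmn⟩ := PeriodPair.mem_lattice.1 h00
  have p₃ : ¬ (2 ∣ (α - γ) ∧ 2 ∣ (β - δ)) := by
    have e' : 2 * (w₁ - w₁') = (α - γ + 2 * m : ℤ) * L.ω₁ + (β - δ + 2 * n : ℤ) * L.ω₂ := by
      push_cast
      linear_combination hαβ' - hγδ' - 2 * hmn
    have := not_two_dvd_of_weierstrassP_ne e' hqr.symm
    rintro ⟨ha, hb⟩
    exact this ⟨(Int.dvd_add_right ha).2 (dvd_mul_right 2 m), (Int.dvd_add_right hb).2 (dvd_mul_right 2 n)⟩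
  have hD : α * δ - β * γ ≠ 0 := det_ne_zero_of_parity p₁ p₂ p₃
  have hDc : ((α * δ - β * γ : ℤ) : ℂ) ≠ 0 := by exact_mod_cast hD
  set T := w₁ - w₀ with hTdef
  set T' := w₁' - w₀' with hT'def
  have hω₁ : L.ω₁ = ((α * δ - β * γ : ℤ) : ℂ)⁻¹ * ((2 * δ : ℤ) * T + (-2 * β : ℤ) * T') := by
    rw [eq_inv_mul_iff_mul_eq₀ hDc]
    push_cast
    linear_combination β * hγδ' - δ * hαβ'
  have hω₂ : L.ω₂ = ((α * δ - β * γ : ℤ) : ℂ)⁻¹ * ((-2 * γ : ℤ) * T + (2 * α : ℤ) * T') := by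
    rw [eq_inv_mul_iff_mul_eq₀ hDc]
    push_cast
    linear_combination γ * hαβ' - α * hγδ'
  have hω₁P : IsPeriod L.ω₁ := hω₁ ▸ isPeriod_inv_mul_add hT hT' _ _ _
  have hω₂P : IsPeriod L.ω₂ := hω₂ ▸ isPeriod_inv_mul_add hT hT' _ _ _
  obtain ⟨a, b, rfl⟩ := PeriodPair.mem_lattice.1 hl
  exact IsPeriod.add_holds (IsPeriod.mul_holds (isPeriod_intCast a) hω₁P)
    (IsPeriod.mul_holds (isPeriod_intCast b) hω₂P)

/-! ### Three points in the plane: a vertex whose two segments are clean -/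

/-- Betweenness is exclusive: if `r = p + s(q - p)` with `0 < s < 1` (so `r` lies strictly
between `p ≠ q`), then `q` does not lie on the closed segment from `r` to `p`. [folklore] -/
theorem ne_of_mem_openSegment {p q r : ℂ} (hpq : p ≠ q) {s : ℝ} (hs : s ∈ Ioo (0 : ℝ) 1)
    (hr : r = p + s * (q - p)) {t : ℝ} (ht : t ∈ Icc (0 : ℝ) 1) : r + t * (p - r) ≠ q := by
  intro hq
  rw [hr] at hq
  have h : ((1 - s + t * s : ℝ) : ℂ) * (q - p) = 0 := by
    push_cast
    linear_combination -hq
  have hpos : (0 : ℝ) < 1 - s + t * s := by nlinarith [hs.1, hs.2, ht.1]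
  rcases mul_eq_zero.1 h with h | h
  · exact hpos.ne' (by exact_mod_cast h)
  · exact hpq (sub_eq_zero.1 h).symm

/-- From the open to the closed segment: if `r ≠ p`, `r ≠ q` and `r` is not strictly between `p`
and `q`, then `r` is not on the closed segment `[p, q]`. [folklore] -/
theorem forall_Icc_segment_ne {p q r : ℂ} (hpr : p ≠ r) (hqr : q ≠ r)
    (h : ∀ s ∈ Ioo (0 : ℝ) 1, p + s * (q - p) ≠ r) :
    ∀ s ∈ Icc (0 : ℝ) 1, p + s * (q - p) ≠ r := by
  intro s hs
  rcases eq_or_lt_of_le hs.1 with h0 | h0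
  · subst h0; simpa using hpr
  rcases eq_or_lt_of_le hs.2 with h1 | h1
  · subst h1; simpa using hqr
  exact h s ⟨h0, h1⟩

/-- **A clean vertex among three distinct points of `ℂ`.** Given three distinct points
satisfying a property `P`, one can order them as `p, q, r` so that `r` is not on the closed
segment `[p, q]` and `q` is not on `[p, r]`: if one of the points lies strictly between the other
two take it as `p`, otherwise any choice works. [folklore] -/
theorem exists_vertex_of_three_points {P : ℂ → Prop} {e₁ e₂ e₃ : ℂ} (h₁ : P e₁) (h₂ : P e₂)
    (h₃ : P e₃) (h₁₂ : e₁ ≠ e₂) (h₁₃ : e₁ ≠ e₃) (h₂₃ : e₂ ≠ e₃) :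
    ∃ p q r : ℂ, P p ∧ P q ∧ P r ∧ p ≠ q ∧ p ≠ r ∧ q ≠ r ∧ p + q + r = e₁ + e₂ + e₃ ∧
      (∀ s ∈ Icc (0 : ℝ) 1, p + s * (q - p) ≠ r) ∧ (∀ s ∈ Icc (0 : ℝ) 1, p + s * (r - p) ≠ q) := by
  by_cases hA : ∃ s ∈ Ioo (0 : ℝ) 1, e₃ = e₁ + s * (e₂ - e₁)
  · -- `e₃` is the middle point: vertex `e₃`
    obtain ⟨s, hs, he⟩ := hA
    have he' : e₃ = e₂ + ((1 - s : ℝ) : ℂ) * (e₁ - e₂) := by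
      rw [he]; push_cast; ring
    have hs' : 1 - s ∈ Ioo (0 : ℝ) 1 := ⟨by linarith [hs.2], by linarith [hs.1]⟩
    exact ⟨e₃, e₁, e₂, h₃, h₁, h₂, h₁₃.symm, h₂₃.symm, h₁₂, by ring,
      fun t ht => ne_of_mem_openSegment h₁₂ hs he ht,
      fun t ht => ne_of_mem_openSegment h₁₂.symm hs' he' ht⟩
  by_cases hB : ∃ s ∈ Ioo (0 : ℝ) 1, e₁ = e₂ + s * (e₃ - e₂)
  · -- `e₁` is the middle point: vertex `e₁`
    obtain ⟨s, hs, he⟩ := hB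
    have he' : e₁ = e₃ + ((1 - s : ℝ) : ℂ) * (e₂ - e₃) := by
      rw [he]; push_cast; ring
    have hs' : 1 - s ∈ Ioo (0 : ℝ) 1 := ⟨by linarith [hs.2], by linarith [hs.1]⟩
    exact ⟨e₁, e₂, e₃, h₁, h₂, h₃, h₁₂, h₁₃, h₂₃, by ring,
      fun t ht => ne_of_mem_openSegment h₂₃ hs he ht,
      fun t ht => ne_of_mem_openSegment h₂₃.symm hs' he' ht⟩
  by_cases hC : ∃ s ∈ Ioo (0 : ℝ) 1, e₂ = e₁ + s * (e₃ - e₁)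
  · -- `e₂` is the middle point: vertex `e₂`
    obtain ⟨s, hs, he⟩ := hC
    have he' : e₂ = e₃ + ((1 - s : ℝ) : ℂ) * (e₁ - e₃) := by
      rw [he]; push_cast; ring
    have hs' : 1 - s ∈ Ioo (0 : ℝ) 1 := ⟨by linarith [hs.2], by linarith [hs.1]⟩
    exact ⟨e₂, e₁, e₃, h₂, h₁, h₃, h₁₂.symm, h₂₃, h₁₃, by ring,
      fun t ht => ne_of_mem_openSegment h₁₃ hs he ht,
      fun t ht => ne_of_mem_openSegment h₁₃.symm hs' he' ht⟩
  · -- no point between the other two: vertex `e₁`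
    simp only [not_exists, not_and] at hA hC
    refine ⟨e₁, e₂, e₃, h₁, h₂, h₃, h₁₂, h₁₃, h₂₃, rfl,
      forall_Icc_segment_ne h₁₃ h₂₃ fun s hs h => hA s hs h.symm,
      forall_Icc_segment_ne h₁₂ h₂₃.symm fun s hs h => hC s hs h.symm⟩

/-! ### The three roots of the Weierstrass cubic of a period pair -/

variable (L)

/-- `℘(h)` is a root of `f(x) = 4x³ - g₂x - g₃` for every half-lattice representative `h`
(`h ∉ Λ`, `2h ∈ Λ`): `f(℘(h)) = ℘'(h)² = 0`. [folklore] -/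
theorem cubic_weierstrassP_eq_zero {h : ℂ} (hh : h ∉ L.lattice) (h2 : 2 * h ∈ L.lattice) :
    4 * ℘[L] h ^ 3 - L.g₂ * ℘[L] h - L.g₃ = 0 := by
  rw [← L.derivWeierstrassP_sq h hh, derivWeierstrassP_eq_zero_of_two_mul_mem L h2]
  ring

/-- The roots of the Weierstrass cubic are simple: `f(x) = 0 ⇒ f'(x) = 12x² - g₂ ≠ 0`, because a
double root `x` forces `g₂ = 12x²`, `g₃ = -8x³` and `g₂³ - 27g₃² = 0`, contradicting
`PeriodPair.discr_ne_zero`. [folklore] -/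
theorem cubic_deriv_ne_zero {x : ℂ} (hx : 4 * x ^ 3 - L.g₂ * x - L.g₃ = 0) :
    12 * x ^ 2 - L.g₂ ≠ 0 := by
  intro h
  apply L.discr_ne_zero
  have hg₂ : L.g₂ = 12 * x ^ 2 := by linear_combination -h
  have hg₃ : L.g₃ = -8 * x ^ 3 := by linear_combination -hx + x * h
  rw [hg₂, hg₃]
  ring

/-- Vieta for two roots: if `p ≠ q` are roots of `f` then `4(p² + pq + q²) = g₂`. [folklore] -/
theorem cubic_vieta_two {g₂ g₃ p q : ℂ} (hp : 4 * p ^ 3 - g₂ * p - g₃ = 0)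
    (hq : 4 * q ^ 3 - g₂ * q - g₃ = 0) (hpq : p ≠ q) :
    4 * (p ^ 2 + p * q + q ^ 2) = g₂ := by
  have h : (p - q) * (4 * (p ^ 2 + p * q + q ^ 2) - g₂) = 0 := by linear_combination hp - hq
  have := (mul_eq_zero.1 h).resolve_left (sub_ne_zero.2 hpq)
  linear_combination this

/-- The third root: if `p ≠ q` are roots of `f` then so is `-(p + q)`. [folklore] -/
theorem cubic_third_root {g₂ g₃ p q : ℂ} (hp : 4 * p ^ 3 - g₂ * p - g₃ = 0)
    (hq : 4 * q ^ 3 - g₂ * q - g₃ = 0) (hpq : p ≠ q) :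
    4 * (-(p + q)) ^ 3 - g₂ * (-(p + q)) - g₃ = 0 := by
  have hv := cubic_vieta_two hp hq hpq
  linear_combination hp - (2 * p + q) * hv

/-- A root of `f` other than the two roots `p ≠ q` is the third root `-(p + q)` (so `f` has
exactly the three roots `p, q, -(p + q)`). [folklore] -/
theorem cubic_root_eq_neg_add {g₂ g₃ p q x : ℂ} (hp : 4 * p ^ 3 - g₂ * p - g₃ = 0)
    (hq : 4 * q ^ 3 - g₂ * q - g₃ = 0) (hx : 4 * x ^ 3 - g₂ * x - g₃ = 0) (hpq : p ≠ q)
    (hxp : x ≠ p) (hxq : x ≠ q) : x = -(p + q) := by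
  have h1 := cubic_vieta_two hp hx (Ne.symm hxp)
  have h2 := cubic_vieta_two hq hx (Ne.symm hxq)
  have h : (p - q) * (p + q + x) = 0 := by linear_combination (h1 - h2) / 4
  have := (mul_eq_zero.1 h).resolve_left (sub_ne_zero.2 hpq)
  linear_combination this

/-- The values of `℘` at the half-periods `ω₁/2`, `ω₂/2` are distinct (`(℘, ℘')` separates
`ℂ/Λ`, tree lemma `PeriodPair.sub_mem_lattice_of_weierstrassP_eq`, and `(ω₁ - ω₂)/2 ∉ Λ`).
Whittaker–Watson §20.32. [cite: WhittakerWatson1927, §20.32] -/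
theorem weierstrassP_half_periods_ne : ℘[L] (L.ω₁ / 2) ≠ ℘[L] (L.ω₂ / 2) := by
  intro h
  have h2₁ : 2 * (L.ω₁ / 2) ∈ L.lattice := by
    rw [show 2 * (L.ω₁ / 2) = L.ω₁ by ring]; exact L.ω₁_mem_lattice
  have h2₂ : 2 * (L.ω₂ / 2) ∈ L.lattice := by
    rw [show 2 * (L.ω₂ / 2) = L.ω₂ by ring]; exact L.ω₂_mem_lattice
  have hmem := L.sub_mem_lattice_of_weierstrassP_eq L.ω₁_div_two_notMem_lattice
    L.ω₂_div_two_notMem_lattice h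
    (by rw [derivWeierstrassP_eq_zero_of_two_mul_mem L h2₁,
      derivWeierstrassP_eq_zero_of_two_mul_mem L h2₂])
  have hmem' : ((1 / 2 : ℚ) : ℂ) * L.ω₁ + ((-1 / 2 : ℚ) : ℂ) * L.ω₂ ∈ L.lattice := by
    convert hmem using 1
    push_cast
    ring
  have h1 := (PeriodPair.mul_ω₁_add_mul_ω₂_mem_lattice.1 hmem').1
  norm_num at h1

/-- **The three roots of the Weierstrass cubic of a period pair, with a good vertex.** There are
three distinct roots `p, q, r` of `f(x) = 4x³ - g₂(Λ)x - g₃(Λ)` with `p + q + r = 0` such that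
neither `r` lies on the closed segment `[p, q]` nor `q` on `[p, r]`, in the form consumed by the
segment lift: `(q - p)s + 2p + q ≠ 0` and `(r - p)s + 2p + r ≠ 0` for `s ∈ [0, 1]`
(note `2p + q = p - r`). The roots are `℘(ω₁/2)`, `℘(ω₂/2)` and minus their sum
(Whittaker–Watson §20.32); the vertex is the middle root if the three are collinear.
[cite: WhittakerWatson1927, §20.32] -/
theorem exists_roots_with_vertex :
    ∃ p q r : ℂ, 4 * p ^ 3 - L.g₂ * p - L.g₃ = 0 ∧ 4 * q ^ 3 - L.g₂ * q - L.g₃ = 0 ∧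
      4 * r ^ 3 - L.g₂ * r - L.g₃ = 0 ∧ p ≠ q ∧ p ≠ r ∧ q ≠ r ∧ p + q + r = 0 ∧
      (∀ s ∈ Icc (0 : ℝ) 1, (q - p) * s + (2 * p + q) ≠ 0) ∧
      (∀ s ∈ Icc (0 : ℝ) 1, (r - p) * s + (2 * p + r) ≠ 0) := by
  -- the three roots
  set e₁ := ℘[L] (L.ω₁ / 2) with he₁
  set e₂ := ℘[L] (L.ω₂ / 2) with he₂
  set e₃ := -(e₁ + e₂) with he₃
  have h2₁ : 2 * (L.ω₁ / 2) ∈ L.lattice := by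
    rw [show 2 * (L.ω₁ / 2) = L.ω₁ by ring]; exact L.ω₁_mem_lattice
  have h2₂ : 2 * (L.ω₂ / 2) ∈ L.lattice := by
    rw [show 2 * (L.ω₂ / 2) = L.ω₂ by ring]; exact L.ω₂_mem_lattice
  have hf₁ : 4 * e₁ ^ 3 - L.g₂ * e₁ - L.g₃ = 0 :=
    cubic_weierstrassP_eq_zero L L.ω₁_div_two_notMem_lattice h2₁
  have hf₂ : 4 * e₂ ^ 3 - L.g₂ * e₂ - L.g₃ = 0 :=
    cubic_weierstrassP_eq_zero L L.ω₂_div_two_notMem_lattice h2₂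
  have h₁₂ : e₁ ≠ e₂ := weierstrassP_half_periods_ne L
  have hf₃ : 4 * e₃ ^ 3 - L.g₂ * e₃ - L.g₃ = 0 := cubic_third_root hf₁ hf₂ h₁₂
  have hv := cubic_vieta_two hf₁ hf₂ h₁₂
  have h₁₃ : e₁ ≠ e₃ := by
    intro h
    apply cubic_deriv_ne_zero L hf₁
    have : e₂ = -2 * e₁ := by rw [he₃] at h; linear_combination h
    rw [← hv, this]
    ring
  have h₂₃ : e₂ ≠ e₃ := by
    intro h
    apply cubic_deriv_ne_zero L hf₂
    have : e₁ = -2 * e₂ := by rw [he₃] at h; linear_combination h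
    rw [← hv, this]
    ring
  -- a good vertex among three distinct points
  obtain ⟨p, q, r, hp, hq, hr, hpq, hpr, hqr, hsum, hs₁, hs₂⟩ :=
    exists_vertex_of_three_points (P := fun x => 4 * x ^ 3 - L.g₂ * x - L.g₃ = 0)
      hf₁ hf₂ hf₃ h₁₂ h₁₃ h₂₃
  have hsum0 : p + q + r = 0 := by rw [hsum, he₃]; ring
  refine ⟨p, q, r, hp, hq, hr, hpq, hpr, hqr, hsum0, fun s hs h0 => hs₁ s hs ?_,
    fun s hs h0 => hs₂ s hs ?_⟩
  · linear_combination h0 - hsum0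
  · linear_combination h0 - hsum0

end Literature.NumberTheory.Transcendental
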